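import Literature.Barriers.RiemannHypothesis.EpsteinZetaRealZerosTripleGrouping
import HarnessLib

/-!
# Low's grouping with TWO near-round partner classes (`4/5 ≤ y ≤ 5/4`): the second mixed criterion

Barrier audit (D-0021) of `Literature.Barriers.RiemannHypothesis.EpsteinZetaRealZeros`, continued
(generation 9, 2026-08-27). Everything in this file is PROVED (theorems only).

For `d = 547` (`h = 3`, partner classes `(11, ±5, 13)` of height `√547/22 = 1.06`) and `d = 568`
(partners `(11, ±2, 13)`, height `1.08`) the constant-term remainder bound of the tree
(`48√y e^{−1.4πy} ≈ 0.46`) is too crude, while the majorant bound of `re_Λ_le_of_im_le_one` asks for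
`y ≤ 1`. Since `ϑ(yt)ϑ(t/y)` is symmetric under `y ↦ 1/y`, the same majorant argument with `y' = 1/y`
gives **`Re Λ_z(σ) ≤ 5/6 − 1/σ − 1/(1−σ)` for `1 ≤ y ≤ 5/4`** (`re_Λ_le_of_im_le_five_fourths`). With TWO
such partners the principal class obeys the cell check `W·(H − 2) ≤ 4 − (1 − p²)B`, `B = β₁ + 5/6`
(`mixed2_cell`; twice the constant of `mixed_cell`), assembled in `re_Λ_add3_lt_of_mixed2Key` and
then in the generic `re_add3_neg_of_Ioo_half_one` / `triple_re_neg_of_Λ` / `LFunction_re_pos_of_triple`.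

## References

* [Low1968] M. E. Low, Acta Arith. 14 (1968) 117–140, Theorem 5 (via MR 38#4425).
* [BatemanGrosswald1964] P. T. Bateman, E. Grosswald, Acta Arith. 9 (1964) 365–373, Theorem 3 (11).
-/

noncomputable section

open Complex Filter Topology MeasureTheory Set HurwitzZeta
open scoped UpperHalfPlane

namespace Literature.Barriers.RiemannHypothesis

open Literature.NumberTheory.Automorphic
open Literature.NumberTheory.LFunctions.RealZeros

/-! ## Near-round classes with `1 ≤ y ≤ 5/4` -/

/-- **Near-round classes just above the round range, `1 ≤ y = Im z ≤ 5/4`**: for every `0 < σ < 1`,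
`Re Λ_z(σ) ≤ 5/6 − 1/σ − 1/(1−σ)`. The majorant argument of `re_Λ_le_of_im_le_one` with `y' = 1/y ∈
[4/5, 1]`: `Θ_z(t) ≤ ϑ(yt)ϑ(t/y) = ϑ(y't)ϑ(t/y')` and `thetaProd_sub_one_le` for `y'` give
`Θ_z(t) − 1 ≤ Ke^{−πy't}` (`t ≥ 1`, `K ≤ 7`), hence `Re Λ₀,z(σ) ≤ 2Ke^{−πy'}/(πy') ≤ 5/6`.
[cite: BatemanGrosswald1964, Theorem 3 (11)] -/
theorem re_Λ_le_of_im_le_five_fourths (z : ℍ) (hy1 : 1 ≤ z.im) (hy54 : z.im ≤ 5 / 4) {σ : ℝ}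
    (hσ0 : 0 < σ) (hσ1 : σ < 1) :
    ((thetaFEPair z).Λ σ).re ≤ 5 / 6 - 1 / σ - 1 / (1 - σ) := by
  have hz0 : 0 < z.im := z.im_pos
  set y : ℝ := 1 / z.im with hydef
  have hy0 : 0 < y := by rw [hydef]; positivity
  have hy45 : 4 / 5 ≤ y := by rw [hydef, le_div_iff₀ hz0]; linarith
  have hy1' : y ≤ 1 := by rw [hydef, div_le_iff₀ hz0]; linarith
  have hπ := Real.pi_gt_three
  have hπy : 12 / 5 ≤ Real.pi * y := by nlinarith
  have hq : Real.exp (-Real.pi * y) ≤ 1 / 7 := by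
    refine le_trans (Real.exp_le_exp.2 (by linarith)) exp_neg_two_lt.le
  have hq0 : 0 < Real.exp (-Real.pi * y) := Real.exp_pos _
  have hθ1 : evenKernel 0 1 ≤ 5 / 3 := by
    have h := evenKernel_zero_sub_one_le one_pos
    rw [mul_one] at h
    have hq4 := exp_neg_pi_le
    have h0 : 0 < Real.exp (-Real.pi) := Real.exp_pos _
    have : 2 * Real.exp (-Real.pi) / (1 - Real.exp (-Real.pi)) ≤ 2 / 3 := by
      rw [div_le_div_iff₀ (by linarith) (by norm_num)]
      linarith
    linarith
  have hθ0 : 1 ≤ evenKernel 0 1 := one_le_evenKernel_zero one_pos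
  set K : ℝ := 2 * (evenKernel 0 1 + 1) / (1 - Real.exp (-Real.pi * y)) with hK
  have hK0 : 0 ≤ K := by rw [hK]; exact div_nonneg (by linarith) (by linarith)
  have hK7 : K ≤ 7 := by
    rw [hK, div_le_iff₀ (by linarith)]
    linarith
  set E : ℝ → ℂ := fun t =>
    (((Ioi (1 : ℝ)).indicator (fun u : ℝ => K * Real.exp (-(Real.pi * y) * u)) t : ℝ) : ℂ) with hE
  obtain ⟨hEconv, hEre⟩ := expPiece_mellin_of_le_one hK0 (by positivity : 0 < Real.pi * y) hE hσ1.le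
  obtain ⟨hEconv', hEre'⟩ :=
    expPiece_mellin_of_le_one hK0 (by positivity : 0 < Real.pi * y) hE (s := 1 - σ) (by linarith)
  have hF0 : ∀ t ∈ Ioc (0 : ℝ) 1, E t = 0 := fun t ht => expPiece_of_le_one hE ht.2
  have hpt : ∀ t : ℝ, 1 < t → thetaQ z t - 1 ≤ (E t).re := by
    intro t ht
    rw [expPiece_of_one_lt hE ht, Complex.ofReal_re]
    have h1 : thetaQ z t ≤ evenKernel 0 (z.im * t) * evenKernel 0 (t / z.im) :=
      thetaQ_le_evenKernel_mul z (by linarith : 0 < t)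
    have h2 := thetaProd_sub_one_le hy0 hy1' ht.le
    have e1 : y * t = t / z.im := by rw [hydef]; ring
    have e2 : t / y = z.im * t := by rw [hydef]; field_simp
    rw [e1, e2, mul_comm] at h2
    linarith
  have hae₁ : ∀ᵐ t : ℝ, 1 < t → thetaQ z t - 1 ≤ (E t).re :=
    ae_of_all _ fun t ht => hpt t ht
  have hae₂ : ∀ᵐ t : ℝ, t ∈ Ioo (0 : ℝ) 1 →
      thetaQ z (1 / t) - 1 ≤ (E (1 / t)).re :=
    ae_of_all _ fun t ht => hpt (1 / t) (one_lt_one_div ht.1 ht.2)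
  have h1σ : (1 : ℂ) - (σ : ℂ) = ((1 - σ : ℝ) : ℂ) := by push_cast; ring
  have hEconv'' : MellinConvergent E (1 - (σ : ℂ)) := by rw [h1σ]; exact hEconv'
  have hmaj := re_Λ₀_le_of_majorant z σ hF0 hEconv hEconv'' hae₁ hae₂
  rw [h1σ] at hmaj
  rw [re_Λ_ofReal]
  have hexp : Real.exp (-(Real.pi * y)) ≤ 1 / 7 := by rw [← neg_mul]; exact hq
  have hKq : K * Real.exp (-(Real.pi * y)) ≤ 7 * (1 / 7) :=
    mul_le_mul hK7 hexp (Real.exp_pos _).le (by norm_num)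
  have hfrac : K * Real.exp (-(Real.pi * y)) / (Real.pi * y) ≤ 5 / 12 := by
    rw [div_le_iff₀ (by positivity)]
    linarith
  linarith

/-! ## The cell lemma with two round partners -/

/-- **The mixed cell lemma with TWO round partners.** As `mixed_cell`, for the principal height
`1 ≤ y ≤ Y`, a cell `p ≤ u ≤ q` in `(0, 1)`, certificates `Y^q ≤ X`, `Y^{(1−p)/2} ≤ W`, `0 ≤ M`,
`0 ≤ B ≤ 4`; the single check `W·(H − 2) ≤ 4 − (1 − p²)B` (`H = (1 − p)[(X − 1)/q + (1 + q)M(X + 1)]`)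
gives `y^{(1+u)/2}P(u) + y^{(1−u)/2}N(u) + B − 2/(1+u) − 2/(1−u) ≤ 0` — the left side times
`u(1+u)(1−u)` is `u[w(H_x − 2) + (1 − u²)B − 4]`. [cite: Low1968, Theorem 5 (via MR 38#4425)] -/
theorem mixed2_cell {y Y X W p q u M B : ℝ} {kq nq ke ne : ℕ}
    (hy1 : 1 ≤ y) (hY : y ≤ Y) (hnq : nq ≠ 0) (hq : q * nq = kq) (hX0 : 0 ≤ X)
    (hX : Y ^ kq ≤ X ^ nq) (hne : ne ≠ 0) (he : (1 - p) / 2 * ne = ke) (hW0 : 0 ≤ W)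
    (hW : Y ^ ke ≤ W ^ ne)
    (hpu : p ≤ u) (hu0 : 0 < u) (huq : u ≤ q) (hu1 : u < 1) (hp0 : 0 ≤ p) (hM : 0 ≤ M)
    (hB0 : 0 ≤ B) (hB2 : B ≤ 4)
    (hcell : W * ((1 - p) * ((X - 1) / q + (1 + q) * (M * (X + 1))) - 2) ≤ 4 - (1 - p ^ 2) * B) :
    y ^ ((1 + u) / 2) * (M - 1 / (1 + u) + 1 / u) + y ^ ((1 - u) / 2) * (M - 1 / (1 - u) - 1 / u) +
      B - 2 / (1 + u) - 2 / (1 - u) ≤ 0 := by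
  have hy0 : 0 < y := by linarith
  have hq0 : 0 < q := lt_of_lt_of_le hu0 huq
  have hY0 : 0 ≤ Y := by linarith
  -- the certificates as real-power bounds
  replace hX : Y ^ q ≤ X := rpow_le_of_pow_le hY0 hX0 hnq hq hX
  replace hW : Y ^ ((1 - p) / 2) ≤ W := rpow_le_of_pow_le hY0 hW0 hne he hW
  set x : ℝ := y ^ u with hx
  set w : ℝ := y ^ ((1 - u) / 2) with hw
  have hx1 : 1 ≤ x := Real.one_le_rpow hy1 hu0.le
  have hxX : x ≤ X := by
    calc x ≤ y ^ q := Real.rpow_le_rpow_of_exponent_le hy1 huq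
      _ ≤ Y ^ q := Real.rpow_le_rpow hy0.le hY hq0.le
      _ ≤ X := hX
  have hw1 : 1 ≤ w := Real.one_le_rpow hy1 (by linarith)
  have hwW : w ≤ W := by
    calc w ≤ y ^ ((1 - p) / 2) := Real.rpow_le_rpow_of_exponent_le hy1 (by linarith)
      _ ≤ Y ^ ((1 - p) / 2) := Real.rpow_le_rpow hy0.le hY (by linarith)
      _ ≤ W := hW
  have e1 : y ^ ((1 + u) / 2) = w * x := by
    rw [hw, hx, ← Real.rpow_add hy0]; congr 1; ring
  -- `H_x ≤ H`
  have hD : (x - 1) / u ≤ (X - 1) / q := by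
    calc (x - 1) / u ≤ (y ^ q - 1) / q := rpow_sub_one_div_le hy1 hu0 huq
      _ ≤ (X - 1) / q := by
          apply div_le_div_of_nonneg_right _ hq0.le
          linarith [(Real.rpow_le_rpow hy0.le hY hq0.le).trans hX]
  have hD0 : 0 ≤ (x - 1) / u := div_nonneg (by linarith) hu0.le
  set Hx : ℝ := (1 - u) * ((x - 1) / u) + (1 - u) * (1 + u) * (M * (x + 1)) with hHx
  set Hc : ℝ := (1 - p) * ((X - 1) / q + (1 + q) * (M * (X + 1))) with hHc
  have hHle : Hx ≤ Hc := by
    have hT0 : 0 ≤ M * (x + 1) := by positivity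
    have hT : M * (x + 1) ≤ M * (X + 1) := by
      have := mul_le_mul_of_nonneg_left (add_le_add_right hxX 1) hM
      linarith
    calc Hx = (1 - u) * ((x - 1) / u) + (1 - u) * (1 + u) * (M * (x + 1)) := rfl
      _ ≤ (1 - p) * ((X - 1) / q) + (1 - p) * (1 + q) * (M * (X + 1)) := by
          refine add_le_add (mul_le_mul (by linarith) hD hD0 (by linarith)) ?_
          exact mul_le_mul (mul_le_mul (by linarith) (by linarith) (by linarith) (by linarith))
            hT hT0 (mul_nonneg (by linarith) (by linarith))
      _ = Hc := by rw [hHc]; ring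
  -- `w (H_x − 2) ≤ max(W (Hc − 2), 0)` and `(1 − u²)B ≤ (1 − p²)B`
  have hwH : w * (Hx - 2) + (1 - u ^ 2) * B ≤ 4 := by
    have hup : (1 - u ^ 2) * B ≤ (1 - p ^ 2) * B := by
      apply mul_le_mul_of_nonneg_right _ hB0
      nlinarith
    rcases le_or_gt Hc 2 with hc | hc
    · have : w * (Hx - 2) ≤ 0 := mul_nonpos_of_nonneg_of_nonpos (by linarith) (by linarith)
      have : (1 - u ^ 2) * B ≤ 4 := by nlinarith
      linarith
    · have h1 : w * (Hx - 2) ≤ w * (Hc - 2) := mul_le_mul_of_nonneg_left (by linarith) (by linarith)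
      have h2 : w * (Hc - 2) ≤ W * (Hc - 2) := mul_le_mul_of_nonneg_right hwW (by linarith)
      linarith
  -- clear denominators: `u(1+u)(1−u) · f = u · [w(H_x − 2) + (1 − u²)B − 2]`
  have hu : u ≠ 0 := hu0.ne'
  have h1u : 1 + u ≠ 0 := by linarith
  have h1u' : 1 - u ≠ 0 := by linarith
  have hpos : 0 < u * (1 + u) * (1 - u) := mul_pos (mul_pos hu0 (by linarith)) (by linarith)
  rw [e1]
  have key : (w * x * (M - 1 / (1 + u) + 1 / u) + w * (M - 1 / (1 - u) - 1 / u) +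
      B - 2 / (1 + u) - 2 / (1 - u)) * (u * (1 + u) * (1 - u)) =
      u * (w * (Hx - 2) + (1 - u ^ 2) * B - 4) := by
    rw [hHx]
    field_simp
    ring
  by_contra hneg
  have hlt : 0 < (w * x * (M - 1 / (1 + u) + 1 / u) + w * (M - 1 / (1 - u) - 1 / u) +
      B - 2 / (1 + u) - 2 / (1 - u)) * (u * (1 + u) * (1 - u)) :=
    mul_pos (lt_of_not_ge hneg) hpos
  rw [key] at hlt
  have : u * (w * (Hx - 2) + (1 - u ^ 2) * B - 4) ≤ 0 :=
    mul_nonpos_of_nonneg_of_nonpos hu0.le (by linarith)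
  linarith


/-! ## The analytic core with two near-round partners -/

/-- A near-round class, `4/5 ≤ y ≤ 5/4`: `Re Λ_z(σ) ≤ 5/6 − 1/σ − 1/(1−σ)` on `(0, 1)` (the two cases
`y ≤ 1`, `y ≥ 1`). [cite: BatemanGrosswald1964, Theorem 3 (11)] -/
theorem re_Λ_le_of_near_round (z : ℍ) (hlo : 4 / 5 ≤ z.im) (hhi : z.im ≤ 5 / 4) {σ : ℝ}
    (hσ0 : 0 < σ) (hσ1 : σ < 1) :
    ((thetaFEPair z).Λ σ).re ≤ 5 / 6 - 1 / σ - 1 / (1 - σ) := by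
  rcases le_or_gt z.im 1 with h | h
  · exact re_Λ_le_of_im_le_one z hlo h hσ0 hσ1
  · exact re_Λ_le_of_im_le_five_fourths z h.le hhi hσ0 hσ1

/-- **Analytic core, principal plus two near-round partners.** `1 ≤ y₁` with Bessel allowance `β₁`,
`4/5 ≤ y₂, y₃ ≤ 5/4`; for `½ < σ < 1`, `u = 2σ − 1` (`M = 0.0236`), the key inequality
`y₁^σP(u) + y₁^{1−σ}N(u) + (β₁ + 5/6 + δ) − 2/(1+u) − 2/(1−u) ≤ 0` gives
`Re Λ_{z₁}(σ) + Re Λ_{z₂}(σ) + Re Λ_{z₃}(σ) < −2δ`. [cite: Low1968, Theorem 5 (via MR 38#4425)] -/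
theorem re_Λ_add3_lt_of_mixed2Key (z₁ z₂ z₃ : ℍ) (hy1 : 1 ≤ z₁.im) (h2lo : 4 / 5 ≤ z₂.im)
    (h2hi : z₂.im ≤ 5 / 4) (h3lo : 4 / 5 ≤ z₃.im) (h3hi : z₃.im ≤ 5 / 4) {σ : ℝ} (hσ : 1 / 2 < σ)
    (hσ1 : σ < 1) {β₁ δ : ℝ}
    (hE1 : 48 * Real.sqrt z₁.im * Real.exp (-(7 / 5) * Real.pi * z₁.im) ≤ 2 * β₁)
    (hkey : z₁.im ^ σ * (0.0236 - 1 / (1 + (2 * σ - 1)) + 1 / (2 * σ - 1)) +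
      z₁.im ^ (1 - σ) * (0.0236 - 1 / (1 - (2 * σ - 1)) - 1 / (2 * σ - 1)) +
      (β₁ + 5 / 6 + δ) - 2 / (1 + (2 * σ - 1)) - 2 / (1 - (2 * σ - 1)) ≤ 0) :
    ((thetaFEPair z₁).Λ σ).re + ((thetaFEPair z₂).Λ σ).re + ((thetaFEPair z₃).Λ σ).re <
      -(2 * δ) := by
  have hσ0 : 0 < σ := by linarith
  have h1 := re_Λ_lt_of_decomposition z₁ hy1 hσ hσ1 hE1
  have h2 := re_Λ_le_of_near_round z₂ h2lo h2hi hσ0 hσ1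
  have h3 := re_Λ_le_of_near_round z₃ h3lo h3hi hσ0 hσ1
  have e1 : 1 / σ = 2 * (1 / (1 + (2 * σ - 1))) := by
    field_simp; ring
  have e2 : 1 / (1 - σ) = 2 * (1 / (1 - (2 * σ - 1))) := by
    have : (1 - σ) ≠ 0 := by linarith
    rw [show (1 : ℝ) - (2 * σ - 1) = 2 * (1 - σ) by ring]
    field_simp
  rw [e1, e2] at h2 h3
  have e3 : (2 : ℝ) / (1 + (2 * σ - 1)) = 2 * (1 / (1 + (2 * σ - 1))) := by ring
  have e4 : (2 : ℝ) / (1 - (2 * σ - 1)) = 2 * (1 / (1 - (2 * σ - 1))) := by ring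
  rw [e3, e4] at hkey
  linarith

end Literature.Barriers.RiemannHypothesis
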